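import Summits.QuantumFields.YangMills.Theorems.FluctuationComparisonRegPrIntLS1aAnchorStepContinuousDensity
import Literature.MathematicalPhysics.QuantumFieldTheory.Balaban1983to89.T3RestrictedUnitDensity
import HarnessLib

/-!
# `FluctuationComparisonRegPrIntLS1aResDensityRegSetUniv` — THE `hwin` BINDER OF THE (α) ⟹ CLASS-MEMBERSHIP NODE IS A THEOREM: BAŁABAN'S RENORMALISED DENSITIES
# `ρ_k = T_{k−1}⋯T_0 e^{−β_K A}` (`T3RestrictedUnitDensity.resDensity F γ K univ k`) HAVE CONTINUOUS VERSIONS, SO `Node00.regSet dU_k ρ_k = univ` AND EVERY WINDOW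
# `{PlaqSmall θ}` LIES IN IT (every `T3Family`, `γ ≥ 0`, every `k ≤ m + K`; no numerics, no smallness)

Cell `ym3-torus` (HUMAN RULING D-0037: rung R3 = continuum SU(2) Yang–Mills on T³ — NOT d = 4, NOT infinite volume, NOT a mass gap, NOT Clay), WIDTH COPY «width 17»
of ym3-torus-p1, seat `ym3-torus-px17` gen 21; `--kind proof --supports stmt-QuantumFields-20520 --as helper` (count-neutral; crux `FluctuationComparisonRegPrIntL`, LINE
`Lines/runpair_organ.lean`, stub S1aᴴ `stub_runClassMembershipH` conjunct (m) via the (α)-node).  THEOREMS ONLY (no `def`, no `sorry`, no `instance`, no `notation`).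

WHY.  px8 g23∕g24's (α) ⟹ class-membership node (UV3-NODE §69.10–§69.12; ✓p824320 `…S1aAlphaMemOfFullTriv.mem_canonVersion_of_alphaFullTriv`, ✓p825116) reads S1aᴴ (m) off ONE
package name modulo SIX displayed binders; the first is
`hwin : {V : GaugeField (F.P K) k SU(2) | PlaqSmall (θBal F.L γ b₀ p₀ (K − k)) V} ⊆ Node00.regSet (fieldMeasure (F.P K) k SU(2)) (resDensity F γ K Set.univ k)`
(§67.3 (c) at level `k`; «px17's cut-step engine ∕ iterate» in §69.11's table).  THIS FILE discharges it OUTRIGHT, for every window and every level, from the seat's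
uncut-step theorem ✓`…S1aOneStepContinuousDensity.exists_continuous_density_map_avgFun_of_continuous` (full guard, no smallness) + px20 g22's (F4-c): iterating the typed
averaging `k` times inside `F.P K` from the Gibbs weight `e^{−β_K A}` (continuous, bounded) gives a continuous bounded density `g_k` of the level-`k` law; Bałaban's `ρ_k`
is a density of the SAME law ([Balaban1985UV3] (2)∕(6), lit ✓`T3RestrictedUnitDensity.integral_resDensity_mul`), hence `ρ_k = g_k` a.e. and `regSet dU_k ρ_k = univ`.

WHAT IS PROVED (0 def, 0 sorry; nothing of Bałaban's asserted).
§1 ★★ `exists_continuous_density_map_avgFun` — HYPOTHESIS-FREE one-step theorem at general `(P, j)`, `j + 1 ≤ m + K`: `(dU_j·ρ).map (avgFun ℰp) = dU_{j+1}·g`, `g` continuous,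
   `≥ 0`, bounded, for every measurable continuous bounded `ρ ≥ 0` ((F4-c) plugged at `η` = the additive Haar measure of a basis of `𝔰𝔲(2)`).
§2 ★★ `exists_continuous_density_map_iter` — the same for the `k`-fold iterate `Averaging.iter (fun j => blockAvg ℰp) k`, `k ≤ m + K` (induction; `blockAvg_avg`).
§3 ★★★ `exists_continuous_ae_eq_resDensity` (`∃ g` continuous bounded `≥ 0` with `resDensity F γ K univ k =ᵐ[dU_k] g`), ★★★ `regSet_resDensity_eq_univ`, and the binder
   VERBATIM ★★★ `plaqSmall_subset_regSet_resDensity` (any radius `θ`, in particular `θBal F.L γ b₀ p₀ (K − k)`).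

HONEST FRAMING.  Measure theory of the typed (0.4) averaging on compact groups over landed files; ONE of the six binders of the (α)-node is discharged (the other five —
`hlowc`∕`hupc` or majorant, `hRegClass`, `hlfle`, `hlarge` — and the (α) package itself for the actual runs are untouched); S1aᴴ (m), the five registered stubs, crux 20520 ∕
19936 ∕ 19200 and `YM3TorusSU2` NOT proved; nothing of Bałaban's renormalization-group analysis is asserted or proved; rung R3 = SU(2) YM₃ on T³ — NOT d = 4, NOT infinite
volume, NOT a mass gap, NOT Clay; the Yang–Mills mass gap is NOT proved by any of this.
References: [Balaban1985UV3] (2) p. 256, (6)–(7) p. 257, (41) p. 266, p. 263 (c); [Balaban1987RG1] (0.4) p. 253, (0.13) p. 254.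
-/

set_option autoImplicit false

noncomputable section

open MeasureTheory Set Function Filter Topology
open scoped ENNReal Matrix.Norms.L2Operator
open Literature.MathematicalPhysics.QuantumFieldTheory.Balaban1983to89
open Literature.MathematicalPhysics.QuantumFieldTheory.Balaban1983to89.T3ContinuumYM3Torus
open Literature.MathematicalPhysics.QuantumFieldTheory.Balaban1983to89.T3UnitLawDensityEML (ℰp)
open Literature.MathematicalPhysics.QuantumFieldTheory.Balaban1983to89.T3RestrictedUnitDensity (resDensity measurable_resDensity integrable_resDensity
  integral_resDensity_mul resDensity_nonneg)
open Literature.MathematicalPhysics.QuantumFieldTheory.Balaban1983to89.BlockAveraging (avgFun blockAvg blockAvg_avg measurable_avgFun)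
open Literature.MathematicalPhysics.QuantumFieldTheory.Balaban1983to89.ExpMeanLog (expMeanLogSU deltaSU deltaSU_pos measurable_expMeanLogSU_E)
open Literature.MathematicalPhysics.QuantumFieldTheory.Balaban1983to89.Missing (boltzmann boltzmann_pos boltzmann_le_one)
open Literature.MathematicalPhysics.QuantumFieldTheory.Balaban1983to89.B16Thm1BaseAtRecord11 (continuous_wilsonAction4_SU)
open Summit.QuantumFields.YangMills.Theorems.FluctuationComparisonRegPrIntLS1aOneStepContinuousDensity (exists_continuous_density_map_avgFun_of_continuous)
open Summit.QuantumFields.YangMills.Theorems.FluctuationComparisonRegPrIntLS1aChartSideNullTraces (pi_setOf_chart_mem_boundarySlice_eq_zero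
  pi_setOf_chart_mem_guardSphere_eq_zero)

namespace Summit.QuantumFields.YangMills.Theorems.FluctuationComparisonRegPrIntLS1aResDensityRegSetUniv

/-! ## §1 One step at general `(P, j)`: the typed averaging preserves «bounded continuous density» — hypothesis-free -/

section OneStep

variable {P : Params} {j : ℕ}

/-- ★★ **ONE UNCUT (0.4) STEP PRESERVES «BOUNDED CONTINUOUS DENSITY», HYPOTHESIS-FREE** (`j + 1 ≤ m + K`): for every measurable continuous bounded `ρ ≥ 0`,
`(dU_j·ρ).map (avgFun ℰp) = dU_{j+1}·g` with `g ≥ 0` continuous and bounded (✓`exists_continuous_density_map_avgFun_of_continuous` with the (F4-c) null traces of px20 g22's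
✓`…S1aChartSideNullTraces` at `η` = the additive Haar measure of a basis of `𝔰𝔲(2)`, Borel σ-algebra). [cite: Balaban1987RG1, (0.4) p.253, (0.13) p.254] -/
theorem exists_continuous_density_map_avgFun (hj : j + 1 ≤ P.m + P.K)
    (ρ : GaugeField P j ↥(Matrix.specialUnitaryGroup (Fin 2) ℂ) → ℝ) (hρm : Measurable ρ) (hρc : Continuous ρ) (hρ0 : ∀ U, 0 ≤ ρ U) (hρC : ∃ C₀ : ℝ, ∀ U, ρ U ≤ C₀) :
    ∃ g : GaugeField P (j + 1) ↥(Matrix.specialUnitaryGroup (Fin 2) ℂ) → ℝ, Continuous g ∧ (∀ V, 0 ≤ g V) ∧ (∃ C : ℝ, ∀ V, g V ≤ C) ∧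
      ((fieldMeasure P j ↥(Matrix.specialUnitaryGroup (Fin 2) ℂ)).withDensity (fun U => ENNReal.ofReal (ρ U))).map (avgFun (expMeanLogSU (n := Fin 2))) =
        (fieldMeasure P (j + 1) ↥(Matrix.specialUnitaryGroup (Fin 2) ℂ)).withDensity (fun V => ENNReal.ofReal (g V)) := by
  classical
  haveI : BorelSpace (GaugeField P (j + 1) ↥(Matrix.specialUnitaryGroup (Fin 2) ℂ)) := T3OrbitAverage.instBorelSpaceGaugeField
  haveI : CompactSpace (GaugeField P (j + 1) ↥(Matrix.specialUnitaryGroup (Fin 2) ℂ)) :=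
    inferInstanceAs (CompactSpace (PBond P (j + 1) → ↥(Matrix.specialUnitaryGroup (Fin 2) ℂ)))
  letI : MeasurableSpace (specialUnitaryLogChart (Fin 2)).lie := borel _
  haveI : BorelSpace (specialUnitaryLogChart (Fin 2)).lie := ⟨rfl⟩
  set η : Measure (specialUnitaryLogChart (Fin 2)).lie := (Module.finBasis ℝ (specialUnitaryLogChart (Fin 2)).lie).addHaar with hη
  obtain ⟨g, hgc, hg0, hset⟩ := exists_continuous_density_map_avgFun_of_continuous (P := P) (j := j) η hj
    (fun E hE U₀ c v => pi_setOf_chart_mem_boundarySlice_eq_zero η hj U₀ c (deltaSU_pos (n := Fin 2)).ne' E hE v)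
    (fun U₀ c v => pi_setOf_chart_mem_guardSphere_eq_zero η hj U₀ c (deltaSU_pos (n := Fin 2)).ne' v) ρ hρm hρ0 hρC hρc
  have hAm : Measurable (avgFun (expMeanLogSU (n := Fin 2)) :
      GaugeField P j ↥(Matrix.specialUnitaryGroup (Fin 2) ℂ) → GaugeField P (j + 1) ↥(Matrix.specialUnitaryGroup (Fin 2) ℂ)) :=
    measurable_avgFun _ measurable_expMeanLogSU_E
  obtain ⟨C, hC⟩ : ∃ C : ℝ, ∀ V, g V ≤ C := by
    obtain ⟨C, hC⟩ := isCompact_univ.exists_bound_of_continuousOn hgc.continuousOn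
    exact ⟨C, fun V => (le_abs_self _).trans ((Real.norm_eq_abs _).symm.le.trans (hC V (mem_univ V)))⟩
  refine ⟨g, hgc, hg0, ⟨C, hC⟩, ?_⟩
  ext S' hS'
  rw [Measure.map_apply hAm hS', withDensity_apply _ hS']
  exact hset S' hS'

end OneStep

/-! ## §2 The `k`-fold iterate inside one lattice `P` -/

section Iterate

variable (P : Params)

/-- The iterate is measurable. [cite: Balaban1987RG1, (0.11) p.253 (bookkeeping)] -/
theorem measurable_iter (k : ℕ) :
    Measurable (Averaging.iter (fun j => blockAvg (P := P) (j := j) (G := ↥(Matrix.specialUnitaryGroup (Fin 2) ℂ)) ℰp) k) := by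
  induction k with
  | zero => exact measurable_id
  | succ k ih => exact (measurable_avgFun _ measurable_expMeanLogSU_E).comp ih

/-- ★★ **THE ITERATED AVERAGING PRESERVES «BOUNDED CONTINUOUS DENSITY»**: for `k ≤ m + K` and every measurable continuous bounded `ρ₀ ≥ 0` on the finest fields,
`(dU_0·ρ₀).map (Ū^k) = dU_k·g_k` with `g_k ≥ 0` continuous and bounded (`Ū^k = Averaging.iter (blockAvg ℰp) k`, §1 by induction; `ρ₀` continuous, hence measurable).
[cite: Balaban1985UV3, (2) p.256 and (6) p.257; Balaban1987RG1, (0.13) p.254] -/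
theorem exists_continuous_density_map_iter
    (ρ₀ : GaugeField P 0 ↥(Matrix.specialUnitaryGroup (Fin 2) ℂ) → ℝ) (hρc : Continuous ρ₀) (hρ0 : ∀ U, 0 ≤ ρ₀ U) (hρC : ∃ C₀ : ℝ, ∀ U, ρ₀ U ≤ C₀) :
    ∀ k : ℕ, k ≤ P.m + P.K →
      ∃ g : GaugeField P k ↥(Matrix.specialUnitaryGroup (Fin 2) ℂ) → ℝ, Continuous g ∧ (∀ V, 0 ≤ g V) ∧ (∃ C : ℝ, ∀ V, g V ≤ C) ∧
        ((fieldMeasure P 0 ↥(Matrix.specialUnitaryGroup (Fin 2) ℂ)).withDensity (fun U => ENNReal.ofReal (ρ₀ U))).map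
            (Averaging.iter (fun j => blockAvg (P := P) (j := j) (G := ↥(Matrix.specialUnitaryGroup (Fin 2) ℂ)) ℰp) k) =
          (fieldMeasure P k ↥(Matrix.specialUnitaryGroup (Fin 2) ℂ)).withDensity (fun V => ENNReal.ofReal (g V)) := by
  intro k
  induction k with
  | zero =>
    intro _
    refine ⟨ρ₀, hρc, hρ0, hρC, ?_⟩
    show Measure.map id _ = _
    rw [Measure.map_id]
  | succ k ih =>
    intro hk
    haveI : BorelSpace (GaugeField P k ↥(Matrix.specialUnitaryGroup (Fin 2) ℂ)) := T3OrbitAverage.instBorelSpaceGaugeField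
    obtain ⟨g', hg'c, hg'0, hg'C, hmap'⟩ := ih (by omega)
    obtain ⟨g, hgc, hg0, hgC, hmap⟩ := exists_continuous_density_map_avgFun (P := P) (j := k) hk g' hg'c.measurable hg'c hg'0 hg'C
    refine ⟨g, hgc, hg0, hgC, ?_⟩
    have hAm : Measurable (avgFun (expMeanLogSU (n := Fin 2)) :
        GaugeField P k ↥(Matrix.specialUnitaryGroup (Fin 2) ℂ) → GaugeField P (k + 1) ↥(Matrix.specialUnitaryGroup (Fin 2) ℂ)) :=
      measurable_avgFun _ measurable_expMeanLogSU_E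
    have hIm := measurable_iter P k
    show Measure.map (avgFun (expMeanLogSU (n := Fin 2)) ∘ Averaging.iter (fun j => blockAvg (P := P) (j := j) ℰp) k) _ = _
    rw [← Measure.map_map hAm hIm, hmap', hmap]

end Iterate

/-! ## §3 Bałaban's renormalised densities have continuous versions: `regSet dU_k ρ_k = univ`, the `hwin` binder verbatim -/

section ResDensity

variable (F : T3Family) {γ : ℝ}

/-- ★★★ **`ρ_k = T_{k−1}⋯T_0 e^{−β_K A}` IS A.E. EQUAL TO A CONTINUOUS BOUNDED NON-NEGATIVE FUNCTION** (`γ ≥ 0`, `k ≤ m + K`): both are densities w.r.t. `dU_k` of the level-`k`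
law `(Ū^k)_*(e^{−β_K A}·dU_0)` — Bałaban's by (2)∕(6) (lit ✓`integral_resDensity_mul`), the continuous one by §2 from the continuous bounded Gibbs weight.
[cite: Balaban1985UV3, (2) p.256 and (6) p.257, p.263 (c)] -/
theorem exists_continuous_ae_eq_resDensity (hγ : 0 ≤ γ) (K k : ℕ) (hk : k ≤ F.m + K) :
    ∃ g : GaugeField (F.P K) k ↥(Matrix.specialUnitaryGroup (Fin 2) ℂ) → ℝ, Continuous g ∧ (∀ V, 0 ≤ g V) ∧ (∃ C : ℝ, ∀ V, g V ≤ C) ∧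
      resDensity F γ K Set.univ k =ᵐ[fieldMeasure (F.P K) k ↥(Matrix.specialUnitaryGroup (Fin 2) ℂ)] g := by
  classical
  haveI : BorelSpace (GaugeField (F.P K) k ↥(Matrix.specialUnitaryGroup (Fin 2) ℂ)) := T3OrbitAverage.instBorelSpaceGaugeField
  haveI : BorelSpace (GaugeField (F.P K) 0 ↥(Matrix.specialUnitaryGroup (Fin 2) ℂ)) := T3OrbitAverage.instBorelSpaceGaugeField
  have hβ : 0 ≤ (F.scheme ℰp γ).β K := F.scheme_β_nonneg ℰp hγ K
  -- the Gibbs weight is continuous, bounded, non-negative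
  have hbc : Continuous (boltzmann (F.P K) ((F.scheme ℰp γ).β K) : GaugeField (F.P K) 0 ↥(Matrix.specialUnitaryGroup (Fin 2) ℂ) → ℝ) := by
    unfold boltzmann
    exact Real.continuous_exp.comp (continuous_const.mul (continuous_wilsonAction4_SU 2 (F.P K) 0))
  have hk' : k ≤ (F.P K).m + (F.P K).K := hk
  obtain ⟨g, hgc, hg0, hgC, hmap⟩ := exists_continuous_density_map_iter (F.P K) (boltzmann (F.P K) ((F.scheme ℰp γ).β K)) hbc
    (fun U => (boltzmann_pos _ _ U).le) ⟨1, fun U => boltzmann_le_one _ hβ U⟩ k hk'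
  refine ⟨g, hgc, hg0, hgC, ?_⟩
  obtain ⟨C, hC⟩ := hgC
  -- both are densities of the same finite law: compare set integrals
  have hgi : Integrable g (fieldMeasure (F.P K) k ↥(Matrix.specialUnitaryGroup (Fin 2) ℂ)) :=
    (integrable_const (max C 0)).mono' hgc.aestronglyMeasurable
      (Eventually.of_forall fun V => by rw [Real.norm_eq_abs, abs_of_nonneg (hg0 V)]; exact (hC V).trans (le_max_left _ _))
  refine Integrable.ae_eq_of_forall_setIntegral_eq _ _ (integrable_resDensity F K MeasurableSet.univ hγ hk) hgi fun s hs _ => ?_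
  have hIm := measurable_iter (F.P K) k
  -- Bałaban's side: (2)∕(6) with the test function `1_s`
  have h1 := integral_resDensity_mul F K MeasurableSet.univ hγ hk (s.indicator fun _ => (1 : ℝ)) (measurable_const.indicator hs)
    ⟨1, fun V => by by_cases hV : V ∈ s <;> simp [hV]⟩
  have hL : ∫ V in s, resDensity F γ K Set.univ k V ∂fieldMeasure (F.P K) k ↥(Matrix.specialUnitaryGroup (Fin 2) ℂ) =
      ∫ V, resDensity F γ K Set.univ k V * s.indicator (fun _ => (1 : ℝ)) V ∂fieldMeasure (F.P K) k ↥(Matrix.specialUnitaryGroup (Fin 2) ℂ) := by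
    rw [← integral_indicator hs]
    refine integral_congr_ae (Eventually.of_forall fun V => ?_)
    by_cases hV : V ∈ s <;> simp [hV]
  have hR : ∫ U, Set.univ.indicator (boltzmann (F.P K) ((F.scheme ℰp γ).β K)) U *
        s.indicator (fun _ => (1 : ℝ)) (Averaging.iter (fun j => blockAvg (P := F.P K) (j := j) ℰp) k U)
        ∂fieldMeasure (F.P K) 0 ↥(Matrix.specialUnitaryGroup (Fin 2) ℂ) =
      ∫ U in Averaging.iter (fun j => blockAvg (P := F.P K) (j := j) ℰp) k ⁻¹' s, boltzmann (F.P K) ((F.scheme ℰp γ).β K) U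
        ∂fieldMeasure (F.P K) 0 ↥(Matrix.specialUnitaryGroup (Fin 2) ℂ) := by
    rw [← integral_indicator (hIm hs)]
    refine integral_congr_ae (Eventually.of_forall fun U => ?_)
    by_cases hU : U ∈ Averaging.iter (fun j => blockAvg (P := F.P K) (j := j) ℰp) k ⁻¹' s
    · have hU' : Averaging.iter (fun j => blockAvg (P := F.P K) (j := j) ℰp) k U ∈ s := hU
      simp [hU, hU']
    · have hU' : Averaging.iter (fun j => blockAvg (P := F.P K) (j := j) ℰp) k U ∉ s := hU
      simp [hU, hU']
  -- the continuous side: the measure identity of §2 evaluated on `s`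
  have hgs : ∫ V in s, g V ∂fieldMeasure (F.P K) k ↥(Matrix.specialUnitaryGroup (Fin 2) ℂ) =
      ∫ U in Averaging.iter (fun j => blockAvg (P := F.P K) (j := j) ℰp) k ⁻¹' s, boltzmann (F.P K) ((F.scheme ℰp γ).β K) U
        ∂fieldMeasure (F.P K) 0 ↥(Matrix.specialUnitaryGroup (Fin 2) ℂ) := by
    have hmeas : (((fieldMeasure (F.P K) 0 ↥(Matrix.specialUnitaryGroup (Fin 2) ℂ)).withDensity
        (fun U => ENNReal.ofReal (boltzmann (F.P K) ((F.scheme ℰp γ).β K) U))).map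
        (Averaging.iter (fun j => blockAvg (P := F.P K) (j := j) (G := ↥(Matrix.specialUnitaryGroup (Fin 2) ℂ)) ℰp) k)) s =
        ((fieldMeasure (F.P K) k ↥(Matrix.specialUnitaryGroup (Fin 2) ℂ)).withDensity (fun V => ENNReal.ofReal (g V))) s := by rw [hmap]
    rw [Measure.map_apply hIm hs, withDensity_apply _ (hIm hs), withDensity_apply _ hs] at hmeas
    rw [integral_eq_lintegral_of_nonneg_ae (Eventually.of_forall fun V => hg0 V) hgc.aestronglyMeasurable.restrict,
      integral_eq_lintegral_of_nonneg_ae (Eventually.of_forall fun U => (boltzmann_pos _ _ U).le) hbc.aestronglyMeasurable.restrict, hmeas]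
  rw [hL, h1, hR, hgs]

/-- ★★★ **`Node00.regSet dU_k ρ_k = univ`** for Bałaban's renormalised density `ρ_k = resDensity F γ K univ k` (`γ ≥ 0`, `k ≤ m + K`). [cite: Balaban1985UV3, p.263 (c)] -/
theorem regSet_resDensity_eq_univ (hγ : 0 ≤ γ) (K k : ℕ) (hk : k ≤ F.m + K) :
    Node00.regSet (fieldMeasure (F.P K) k ↥(Matrix.specialUnitaryGroup (Fin 2) ℂ)) (resDensity F γ K Set.univ k) = univ := by
  obtain ⟨g, hgc, -, -, hae⟩ := exists_continuous_ae_eq_resDensity F hγ K k hk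
  exact Node00.regSet_eq_univ_of_hasContVersion ⟨g, hgc, hae.symm⟩

/-- ★★★ **THE `hwin` BINDER OF THE (α)-NODE, VERBATIM** (✓`…S1aAlphaMemOfFullTriv.mem_canonVersion_of_alphaFullTriv` ∕ ✓`…S1aAlphaMemCanonMajorantOfRows`): every small-field window
— indeed every set — lies in the maximal regular set of `ρ_k` (`γ ≥ 0`, `k ≤ K`). [cite: Balaban1985UV3, p.263 (c)] -/
theorem plaqSmall_subset_regSet_resDensity (hγ : 0 ≤ γ) {K k : ℕ} (hk : k ≤ K) (θ : ℝ) :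
    {V : GaugeField (F.P K) k ↥(Matrix.specialUnitaryGroup (Fin 2) ℂ) | PlaqSmall θ V} ⊆
      Node00.regSet (fieldMeasure (F.P K) k ↥(Matrix.specialUnitaryGroup (Fin 2) ℂ)) (resDensity F γ K Set.univ k) := by
  rw [regSet_resDensity_eq_univ F hγ K k (by omega)]
  exact subset_univ _

end ResDensity

end Summit.QuantumFields.YangMills.Theorems.FluctuationComparisonRegPrIntLS1aResDensityRegSetUniv

end
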